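/-
Copyright: statement-level skeleton of a published paper (lit-balaban cell, Phase-2 proof seat p25, gen 14). No proof
claims beyond what the kernel checks below.
-/
import Literature.MathematicalPhysics.QuantumFieldTheory.BalabanImbrieJaffe1984to88.BIJ88ConnectedDiagrams312
import Literature.MathematicalPhysics.QuantumFieldTheory.BalabanImbrieJaffe1984to88.BIJ88SlotMomentsGauss308

/-!
# `BalabanImbrieJaffe1984to88.BIJ88IbpFieldLaw312` — T. Bałaban, J. Imbrie, A. Jaffe, *Effective action and cluster
properties of the abelian Higgs model*, Commun. Math. Phys. **114** (1988) 257–315 [BalabanImbrieJaffe1988], §5.14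
pp. 311–312 [PDF 55–56]: the all-orders integration by parts (`BIJ88WickDerivatives305.wick_smooth`) and the component form
of the p. 312 first display (`BIJ88IbpComponents312.ibp_components_display`, `BIJ88ConnectedDiagrams312.ibp_components_display_conn`)
**ON THE MODEL OF RECORD OF §5.13–5.14: THE LAW OF THE FIELDS OF A REGION `W`** (p36's
`BIJ88SlotMomentsGauss308.fieldLaw blk Δ ℱ W` — Lebesgue measure on the fields of the sites of `W` with density
`e^{−½⟨Φ,Δ_{1_W}Φ⟩}e^{⟨ℱ,Φ⟩}`, normalized; p. 304: *"The expectation ⟨ ⟩₁ is in the measure (1/N)∫dΦ … exp[½⟨Φ,ΔΦ⟩ + ⟨Φ,ℱ⟩]"*;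
(5.14.1) p. 308: the Gaussian expectation in which *"We integrate by parts"* (p. 311)).

statement-level skeleton of published theorems with citation tags; proofs where landed; nothing here is a claim
about the Yang–Mills mass gap

PDF held: `paper:balaban1988-cmp114-bij-abelian-higgs-effective-action` (journal page = PDF page + 256).

CITATION HEADER (lean-in-tree rule).  lit-balaban cell, Phase 2, seat p25 gen 14; row **C2.Claim@312** of
`HOME/lit-balaban-r16/ROWS-C2-part2.md` (owner r16, referee ref-5): model instance of this generation's three files
(p323823 `BIJ88WickDerivatives305`, p324427 `BIJ88IbpComponents312`, `BIJ88ConnectedDiagrams312`).  Precision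
`A := prec blk Δ W (1_W)` (the `W`-block of p13's Dirichlet-interpolated form at the corner `1_W`), source `ℱ|_W := src blk ℱ W`,
covariance `C = A⁻¹`; the normalization of `fieldLaw` cancels in every displayed ratio (`integral_fieldLaw`,
`integral_density_pos`).

## What is proved (0 `sorry`, standard axioms, no new `Prop` facts, theorems only)

* **`wick_smooth_fieldLaw`** — for the `W`-block positive definite, legs `v_i` on the sites of `W`, `H ∈ C^∞` with bounded
  derivatives of every order: `∫Π_{i∈T}Φ(v_i)·H dfieldLaw / ∫H dfieldLaw = Σ_{D⊆T}(Σ_{σ∈smallParts(T∖D)}Π w_B)·(∫(Π_{i∈D}∂_{Cv_i})H dfieldLaw / ∫H dfieldLaw)`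
  (the interacting expectation of (5.14.1) with the smooth factor `H`).
* **`ibp_components_display_fieldLaw`** — the p. 312 first display on the law of the fields of `W`:
  `∫Π_σF_σ·H dfieldLaw / ∫H dfieldLaw = Σ_{R⊆U}(Σ_{{X_c}∈setPartitions(U∖R)}Π_c connSum X_c)·(remSum R H / ∫ H e^{−½⟨Φ,AΦ⟩+⟨ℱ,Φ⟩}dΦ)`
  with the remainder factor in the un-normalized currency of `remSum` (the normalization `N` cancels against the numerator's).
HONEST SCOPE: as in the three files (every field integrated by parts; `{X_c}` summed over; one covariance; no estimates);
here only the identification of the measure.  NOT summit progress; NOT continuum; NOT Clay.  Imports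
`BIJ88ConnectedDiagrams312` (p25 gen 14) and `BIJ88SlotMomentsGauss308` (p36 gen 8); modifies nothing.
-/

noncomputable section

namespace Literature.MathematicalPhysics.QuantumFieldTheory.BalabanImbrieJaffe1984to88.BIJ88IbpFieldLaw312

open MeasureTheory Matrix Finset
open scoped BigOperators ContDiff
open Literature.Probability.LatticeModels (setPartitions)
open Literature.MathematicalPhysics.QuantumFieldTheory.Balaban1983to89
open B2Eq228Conditioning (weight source)
open BIJ88PairingAllOrders5133 (smallParts)
open BIJ88WickSource305 (cweight)
open BIJ88WickDerivatives305 (dset wick_smooth_interacting)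
open BIJ88IbpComponents312 (remSum)
open BIJ88ConnectedDiagrams312 (connSum ibp_components_display_conn)
open BIJ88PolymerRep5134 (corner)
open BIJ88PolymerRep5134Gauss (prec src)
open BIJ88SlotMomentsGauss308 (fieldLaw integral_fieldLaw integral_density_pos)

variable {α I : Type} [Fintype α] [DecidableEq α] [Fintype I] [DecidableEq I]
  (blk : α → I) (Δ : Matrix α α ℝ) (ℱ : α → ℝ) (W : Finset I)
variable {κ : Type} [LinearOrder κ] {O : Type} [DecidableEq O]

/-- **The all-orders integration by parts in the interacting expectation ON THE LAW OF THE FIELDS OF `W`**: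
`⟨Π_{i∈T}Φ(v_i)·H⟩/⟨H⟩ = Σ_{D⊆T}(Σ_{σ∈smallParts(T∖D)}Π_{B∈σ}w_B)·⟨(Π_{i∈D}∂_{Cv_i})H⟩/⟨H⟩`, expectations in `fieldLaw blk Δ ℱ W`,
`C = (prec blk Δ W 1_W)⁻¹`, weights with the source `ℱ|_W` (*"those fields can be contracted via covariances … to other
observables, to χ′, or to the interaction"*). [cite: BalabanImbrieJaffe1988, §5.14 p.311] [cite: BalabanImbrieJaffe1988, (5.14.1) p.308] -/
theorem wick_smooth_fieldLaw (hPD : (prec blk Δ W (corner ℝ W)).PosDef) (v : κ → ({x : α // blk x ∈ W} → ℝ))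
    (T : Finset κ) {H : ({x : α // blk x ∈ W} → ℝ) → ℝ} (hH : ContDiff ℝ ∞ H)
    (hb : ∀ k : ℕ, ∃ K : ℝ, ∀ φ, ‖iteratedFDeriv ℝ k H φ‖ ≤ K) :
    (∫ φ, (∏ i ∈ T, φ ⬝ᵥ v i) * H φ ∂(fieldLaw blk Δ ℱ W)) / (∫ φ, H φ ∂(fieldLaw blk Δ ℱ W))
      = ∑ D ∈ T.powerset,
          (∑ σ ∈ smallParts (T \ D), ∏ B ∈ σ, cweight (prec blk Δ W (corner ℝ W)) (src blk ℱ W) v B) *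
          ((∫ φ, dset (prec blk Δ W (corner ℝ W)) v D H φ ∂(fieldLaw blk Δ ℱ W)) /
            ∫ φ, H φ ∂(fieldLaw blk Δ ℱ W)) := by
  have hZ := (integral_density_pos blk Δ ℱ W hPD).ne'
  simp only [integral_fieldLaw, div_div_div_cancel_right₀ hZ]
  exact wick_smooth_interacting _ hPD _ v T hH hb

/-- **THE p. 312 FIRST DISPLAY ON THE LAW OF THE FIELDS OF `W`** (*"⟨Π_{σ₁}F^{m̄}_{k,loc}(X_{σ₁})⟩ =
Σ_{{X_r}} Π_{c: X_c⊄∪_rX_r} F^L_{k+1,loc}(X_c) ⟨Π_r F_{k,rem}(X_r)⟩₁"*): in the expectation of `fieldLaw blk Δ ℱ W` carrying the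
smooth factor `H`, the product of the monomial observables `F_σ = Π_{own i = σ}Φ(v_i)` equals the sum over the remainder
regions `R` and the connected-component structures `{X_c}` of the constant observables of `Π_c connSum X_c` (the connected
contraction diagrams) times the remainder factor `remSum R H` normalized by `∫ H e^{−½⟨Φ,AΦ⟩+⟨ℱ,Φ⟩}dΦ`.
[cite: BalabanImbrieJaffe1988, §5.14 p.312] -/
theorem ibp_components_display_fieldLaw (hPD : (prec blk Δ W (corner ℝ W)).PosDef)
    (v : κ → ({x : α // blk x ∈ W} → ℝ)) {T : Finset κ} {own : κ → O} {U : Finset O} (hU : ∀ i ∈ T, own i ∈ U)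
    {H : ({x : α // blk x ∈ W} → ℝ) → ℝ} (hH : ContDiff ℝ ∞ H) (hb : ∀ k : ℕ, ∃ K : ℝ, ∀ φ, ‖iteratedFDeriv ℝ k H φ‖ ≤ K) :
    (∫ φ, (∏ σ ∈ U, ∏ i ∈ T with own i = σ, φ ⬝ᵥ v i) * H φ ∂(fieldLaw blk Δ ℱ W)) / (∫ φ, H φ ∂(fieldLaw blk Δ ℱ W))
      = ∑ R ∈ U.powerset,
          (∑ P ∈ setPartitions (U \ R), ∏ c ∈ P, connSum (prec blk Δ W (corner ℝ W)) (src blk ℱ W) v T own c) *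
          (remSum (prec blk Δ W (corner ℝ W)) (src blk ℱ W) v T own R H /
            ∫ φ, H φ * (weight (prec blk Δ W (corner ℝ W)) φ * source (src blk ℱ W) φ)) := by
  have hZ := (integral_density_pos blk Δ ℱ W hPD).ne'
  rw [integral_fieldLaw, integral_fieldLaw, div_div_div_cancel_right₀ hZ]
  exact ibp_components_display_conn _ hPD _ v hU hH hb

end Literature.MathematicalPhysics.QuantumFieldTheory.BalabanImbrieJaffe1984to88.BIJ88IbpFieldLaw312
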